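import Literature.MathematicalPhysics.QuantumFieldTheory.Balaban1983to89.B9Eq3105CoordsDirichletBondGY
import Literature.MathematicalPhysics.QuantumFieldTheory.Balaban1983to89.B9KnitCubeRowAgreementY

/-!
# `Balaban1983to89.B9Eq3105CoordsDirichletBondLY` — T. Bałaban, *Propagators for lattice gauge theories in a background field*, Commun. Math. Phys. **99** (1985)
# 389–434 [Balaban1985BackgroundPropagators] (3.105) p. 414 («Δ_aG₀ = Σ_□ h_□² − Σ_□ K(h_□)G_□h_□ − Σ_□ (1 − ζ_□̃)DPD*h_□G_□h_□ − Σ_□ ζ_□̃D(P − P_□)D*h_□G_□h_□ − Σ_□ ζ_□̃P₁(∂h_□)G_□h_□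
# = I − R»), (3.101) p. 414, (3.87) p. 409, p. 409 l. 1–5 («the operators constructed for this sequence … G_□(U)»): ★★ **(3.105) AND ITS TRANSPOSE IN THE rows-19 WALK RECORD's
# COORDINATES AT A GENERIC CUBE-INDEXED FAMILY OF BOND OPERATORS `G_□(U)`** (the four printed families ONCE, letter-free), ★★★ **AND AT THE (C) LETTER OF RECORD
# `G_□(U) = GDirCKY i □ Pl_□ B_□ U`** — print's Dirichlet inverse of the cube sequence `{Ω_n(□)}` keyed on its own knit averaging — with the local-inverse row DISCHARGED by
# the row ∕ column agreement of the knit pairs (✓`B9KnitCubeRowAgreementY`)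

statement-level skeleton of published theorems with citation tags; proofs where landed; nothing here is a claim about the Yang–Mills mass gap

WHAT (seat dag-n06-d g34; the fourth edition of the (3.105) coordinate families after ✓`B9Eq3105CoordsDirichletBondY` v1 ∕ v1.1 and ✓`B9Eq3105CoordsDirichletBondGY`).  The N06 heads
display (3.105) at a member in the currency `S0coKq U · Σ_□ mulOp h_□ · GcoK(G_□) U · mulOp h_□ = 1 − Σ_a R_a(U)` over ONE finite index `□ ⊕ □ ⊕ □ ⊕ □` (their rows `hlawsA`.3∕.4).
✓`…BondGY` keyed the families on def-Y's member-pair Dirichlet letter `GDirBY 𝔮 𝔮⋆ Pl_□ B_□`; the (C) re-key of the bond letter (dag-n06-c LOCATED-34 ∕ this seat's ANSWER,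
2026-08-31) needs them at `GDirCKY`.  THIS FILE states the families ONCE for a GENERIC cube-indexed family of bond operators `Gl : □ ↦ (U ↦ G_□(U))` — so that no further
re-key of the letter touches them — and proves the two coordinate identities from def-Y's exact-law identities ✓`B9Eq3105OfLocalInverseQ.eq3105Q(T)_hT_ofLocalInverse`
under the displayed local-inverse rows `hloc ∕ hlocT`; then AT THE (C) LETTER OF RECORD the rows `hloc ∕ hlocT` are THEOREMS (✓`B9DirichletBondCubePairY.hloc_GDirCY_of_rows ∕
hlocT_GDirCY_of_cols` fed by ✓`B9KnitCubeRowAgreementY.knitRecord_rows∕cols_agree_of_hTY`), leaving displayed only the (3.101) rows, the bond-support rows and the regime.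
* §1 ★ `eq3105FamQLY` ∕ `eq3105FamQTLY` (generic `Gl`, `Plc`, `P1c`), their `Sum.elim` bookkeeping, and the dictionary `eq3105FamQGY = eq3105FamQLY … (□ ↦ GDirBY 𝔮 𝔮⋆ (Plc □) (Bc □))` (`rfl`);
* §2 ★★ `eq3105Q_coords_ofLocalInverse` ∕ `eq3105QT_coords_ofLocalInverse` (generic `Gl`, displayed `hP1`, `hloc ∕ hlocT`);
* §3 ★★★ `eq3105Q_coords_GDirCKY` ∕ `eq3105QT_coords_GDirCKY` at the stage's knit families of record `(qKnitOfRecord, qsKnitOfRecord)` and `Gl □ := GDirCKY i □ (Plc □) (Bc □)`, and the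
  member editions `eq3105Q(T)_coords_GDirCKY_member` with the rows-19 partition letter `hWalkBY x □` (the heads' `hlawsA`.3∕.4 shape at the (C) pins).
HONEST SCOPE.  Identities and bookkeeping over landed letters (2 `def` + 10 thm, 0 `sorry`); no estimate ((3.106) is the certificate's displayed `hfacA`); the regime
`IsUnit (padDeltaLocCY …)` (Cor. 3.6 for the sequences) is displayed; count-neutral (`--supports stmt-QuantumFields-27239`); N06 NOT discharged; nothing continuum ∕ OS ∕ mass gap ∕
Clay — the Yang–Mills mass gap is NOT proved by any of this.  NEW file; nothing landed is modified; no `instance`, no `notation`.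
-/

noncomputable section

namespace Literature.MathematicalPhysics.QuantumFieldTheory.Balaban1983to89.B9Eq3105CoordsDirichletBondLY

open Node00
open B9Thm37Sum (mulOp)
open B9Thm37CubeCoverCommutators (cutMulY hTY)
open B9Eq3104CutoffCommutators (hBdY DPDsY)
open B9Eq3105OfLocalInverseQ (deltaLocQY KhBQY S0coKq_eq_smul_coordAlgHomB GcoK_eq_smul_coordAlgHomB smul_mul_sum_smul_eq sum_smul_mul_smul_eq
  eq3105Q_hT_ofLocalInverse eq3105QT_hT_ofLocalInverse)
open B9Eq3105ZetaY (zetaY zetaY_eq_one_of_hTY_ne_zero)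
open B9Eq3105CoordsDirichletBondGY (eq3105FamQGY eq3105FamQTGY)
open B9Thm39ReadingCoords (cR39)
open B9CoReadingCoords (XBK GcoK)
open B9WalkLettersBondLeib (coordAlgHomB mulOp_bond_eq_coordOpK)
open B6KLevelCensusIndexV1 (KIdx)
open B6Cover236MultiLevelBlocks (cubes)
open B9DirichletBondCubePairY (padDeltaLocCY GDirCY hloc_GDirCY_of_rows hlocT_GDirCY_of_cols)
open B9Eq3115KnitCubeLetterY (QknitCubeY QsknitCubeY GDirCKY)
open B9KnitCubeRowAgreementY (knitRecord_rows_agree_of_hTY knitRecord_cols_agree_of_hTY)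
open Node00.OpsYNablaBridge (chartY)
open Node00.OpsYQLetter (QLetterY QsLetterY qKnitOfRecord qsKnitOfRecord)
open Node00.OpsYOps312OfRecordPar (S0coKq)
open Node00.OpsYCubeDirInverseBond (GDirBY)
open scoped Matrix

variable {d ℓ : ℕ} {hd : 1 ≤ d + 1} {hL : Odd (ℓ + 1) ∧ 1 < ℓ + 1} {b₀ b₁ : ℝ}
variable {𝔸 : Type} [NormedRing 𝔸] [NormedAlgebra ℂ 𝔸] [CompleteSpace 𝔸] [FiniteDimensional ℝ 𝔸] {κ : Type} [Fintype κ]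
variable (i : KIdx d ℓ hd hL b₀ b₁) (b : Module.Basis κ ℝ 𝔸)

/-! ## §1 The four families of (3.105) at a generic cube-indexed family of bond operators `G_□(U)` -/

section Families

variable (𝔮 : QLetterY 𝔸 i) (𝔮s : QsLetterY 𝔸 i) (parS : SiteParY 𝔸 i) (Gp : SiteOpY 𝔸 i)
  (Gl : ↥(cubes i.D.toDomains) → BondOpY 𝔸 i)
  (Plc : ↥(cubes i.D.toDomains) → CfgY 𝔸 i → Module.End ℂ (FBondY i → 𝔸))
  (P1c : ↥(cubes i.D.toDomains) → CfgY 𝔸 i → Module.End ℂ (FBondY i → 𝔸)) (U : CfgY 𝔸 i)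

/-- ★ **THE FOUR FAMILIES OF (3.105) IN COORDINATES AT A GENERIC FAMILY OF CUBE OPERATORS** `G_□(U) = Gl □ U`, `Pl_□ = Plc □` (print's `DP_□D*` for the sequence), `P₁(∂h_□) = P1c □`
(its (3.101) commutator with `M_{h_□}`), `ζ_□̃ = zetaY i □`, the PHYSICAL `DPD*(U) = DPDsY parS Gp U`: `k = 1`: `φ(K[𝔮](h_□)G_□M_{h_□})`; `k = 2`: `φ((1 − M_ζ)DPD*(M_hG_□M_h))`;
`k = 3`: `φ(M_ζ(DPD* − Pl_□)(M_hG_□M_h))`; `k = 4`: `φ(M_ζP₁(∂h_□)G_□M_h)`. [cite: Balaban1985BackgroundPropagators, (3.105) p.414, (3.87) p.409, (3.101) p.414, p.409 l.1–5] -/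
def eq3105FamQLY : ↥(cubes i.D.toDomains) ⊕ ↥(cubes i.D.toDomains) ⊕ ↥(cubes i.D.toDomains) ⊕ ↥(cubes i.D.toDomains) → Module.End ℝ (XBK κ i → ℝ) :=
  Sum.elim (fun c => coordAlgHomB i b (KhBQY i (hTY i c) 𝔮 𝔮s U * Gl c U * cutMulY (hBdY i (hTY i c))))
    (Sum.elim (fun c => coordAlgHomB i b ((1 - cutMulY (hBdY i (zetaY i c))) * DPDsY i parS Gp U *
        (cutMulY (hBdY i (hTY i c)) * Gl c U * cutMulY (hBdY i (hTY i c)))))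
      (Sum.elim (fun c => coordAlgHomB i b (cutMulY (hBdY i (zetaY i c)) * (DPDsY i parS Gp U - Plc c U) *
          (cutMulY (hBdY i (hTY i c)) * Gl c U * cutMulY (hBdY i (hTY i c)))))
        (fun c => coordAlgHomB i b (cutMulY (hBdY i (zetaY i c)) * P1c c U * Gl c U * cutMulY (hBdY i (hTY i c))))))

/-- the TRANSPOSED reading's four families at a generic family of cube operators (signed so that the transposed identity reads `… = 1 − Σ_a`). (transposed reading — bookkeeping)
[cite: Balaban1985BackgroundPropagators, (3.105) p.414, (3.87) p.409, (3.101) p.414] -/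
def eq3105FamQTLY : ↥(cubes i.D.toDomains) ⊕ ↥(cubes i.D.toDomains) ⊕ ↥(cubes i.D.toDomains) ⊕ ↥(cubes i.D.toDomains) → Module.End ℝ (XBK κ i → ℝ) :=
  Sum.elim (fun c => -coordAlgHomB i b (cutMulY (hBdY i (hTY i c)) * Gl c U * KhBQY i (hTY i c) 𝔮 𝔮s U))
    (Sum.elim (fun c => -coordAlgHomB i b (cutMulY (hBdY i (hTY i c)) * Gl c U * P1c c U))
      (Sum.elim (fun c => coordAlgHomB i b (cutMulY (hBdY i (hTY i c)) * Gl c U * cutMulY (hBdY i (hTY i c)) *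
          (cutMulY (hBdY i (zetaY i c)) * (DPDsY i parS Gp U - Plc c U))))
        (fun c => coordAlgHomB i b (cutMulY (hBdY i (hTY i c)) * Gl c U * cutMulY (hBdY i (hTY i c)) *
          ((1 - cutMulY (hBdY i (zetaY i c))) * DPDsY i parS Gp U)))))

omit [FiniteDimensional ℝ 𝔸] in
/-- the `Sum.elim` bookkeeping: `Σ_a eq3105FamQLY a = Σ_□ R¹_□ + (Σ_□ R²_□ + (Σ_□ R³_□ + Σ_□ R⁴_□))`. [cite: Balaban1985BackgroundPropagators, (3.105) p.414, bookkeeping] -/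
theorem sum_eq3105FamQLY :
    ∑ a, eq3105FamQLY i b 𝔮 𝔮s parS Gp Gl Plc P1c U a =
      ∑ c, coordAlgHomB i b (KhBQY i (hTY i c) 𝔮 𝔮s U * Gl c U * cutMulY (hBdY i (hTY i c)))
        + (∑ c, coordAlgHomB i b ((1 - cutMulY (hBdY i (zetaY i c))) * DPDsY i parS Gp U *
            (cutMulY (hBdY i (hTY i c)) * Gl c U * cutMulY (hBdY i (hTY i c))))
        + (∑ c, coordAlgHomB i b (cutMulY (hBdY i (zetaY i c)) * (DPDsY i parS Gp U - Plc c U) *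
            (cutMulY (hBdY i (hTY i c)) * Gl c U * cutMulY (hBdY i (hTY i c))))
        + ∑ c, coordAlgHomB i b (cutMulY (hBdY i (zetaY i c)) * P1c c U * Gl c U * cutMulY (hBdY i (hTY i c))))) := by
  simp only [eq3105FamQLY, Fintype.sum_sum_type, Sum.elim_inl, Sum.elim_inr]

omit [FiniteDimensional ℝ 𝔸] in
/-- the same for the transposed families. [cite: Balaban1985BackgroundPropagators, (3.105) p.414, bookkeeping] -/
theorem sum_eq3105FamQTLY :
    ∑ a, eq3105FamQTLY i b 𝔮 𝔮s parS Gp Gl Plc P1c U a =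
      ∑ c, -coordAlgHomB i b (cutMulY (hBdY i (hTY i c)) * Gl c U * KhBQY i (hTY i c) 𝔮 𝔮s U)
        + (∑ c, -coordAlgHomB i b (cutMulY (hBdY i (hTY i c)) * Gl c U * P1c c U)
        + (∑ c, coordAlgHomB i b (cutMulY (hBdY i (hTY i c)) * Gl c U * cutMulY (hBdY i (hTY i c)) *
            (cutMulY (hBdY i (zetaY i c)) * (DPDsY i parS Gp U - Plc c U)))
        + ∑ c, coordAlgHomB i b (cutMulY (hBdY i (hTY i c)) * Gl c U * cutMulY (hBdY i (hTY i c)) *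
            ((1 - cutMulY (hBdY i (zetaY i c))) * DPDsY i parS Gp U)))) := by
  simp only [eq3105FamQTLY, Fintype.sum_sum_type, Sum.elim_inl, Sum.elim_inr]

omit [FiniteDimensional ℝ 𝔸] in
/-- dictionary: at `Gl □ := GDirBY 𝔮 𝔮⋆ (Plc □) (Bc □)` (def-Y's member-pair Dirichlet letter) the generic families ARE ✓`B9Eq3105CoordsDirichletBondGY.eq3105FamQGY` (`rfl`).
[cite: Balaban1985BackgroundPropagators, (3.105) p.414, bookkeeping] -/
theorem eq3105FamQLY_GDirBY (Bc : ↥(cubes i.D.toDomains) → Finset (FBondY i)) :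
    eq3105FamQLY i b 𝔮 𝔮s parS Gp (fun c => GDirBY i 𝔮 𝔮s (Plc c) (Bc c)) Plc P1c U = eq3105FamQGY i b 𝔮 𝔮s parS Gp Plc P1c Bc U := rfl

omit [FiniteDimensional ℝ 𝔸] in
/-- dictionary, transposed families. [cite: Balaban1985BackgroundPropagators, (3.105) p.414, bookkeeping] -/
theorem eq3105FamQTLY_GDirBY (Bc : ↥(cubes i.D.toDomains) → Finset (FBondY i)) :
    eq3105FamQTLY i b 𝔮 𝔮s parS Gp (fun c => GDirBY i 𝔮 𝔮s (Plc c) (Bc c)) Plc P1c U = eq3105FamQTGY i b 𝔮 𝔮s parS Gp Plc P1c Bc U := rfl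

end Families

/-! ## §2 (3.105) and its transpose in the record's coordinates at a generic family of cube operators, under the local-inverse rows -/

section Coords

variable (B : B9.Backgrounds) (cfg : B.Cfg → CfgY 𝔸 i)
variable (𝔮 : QLetterY 𝔸 i) (𝔮s : QsLetterY 𝔸 i) (parS : SiteParY 𝔸 i) (Gp : SiteOpY 𝔸 i)

/-- ★★ **(3.105) IN THE WALK RECORD's COORDINATES AT A GENERIC FAMILY OF CUBE OPERATORS** `G_□(U) = Gl □ U`: with `h_□` read on the bond carrier, `Δ_a[𝔮]` as `S0coKq … Gp`, the
cube operators read as `GcoK`, `ζ_□̃ = zetaY i □`: `S0coKq U · Σ_□ mulOp h_□ · GcoK(G_□) U · mulOp h_□ = 1 − Σ_a eq3105FamQLY … a`.  Displayed premises: the (3.101) commutator row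
`hP1` and the LOCAL-INVERSE row `hloc : M_{h_□}(Δ_loc[𝔮] − Pl_□)G_□M_{h_□} = M_{h_□}²` (def-Y's ✓`eq3105Q_hT_ofLocalInverse`, read through the algebra morphism `coordAlgHomB`).
[cite: Balaban1985BackgroundPropagators, (3.105) p.414, (3.101) p.414, (3.87) p.409, p.409 l.1–5, (3.42) p.397] -/
theorem eq3105Q_coords_ofLocalInverse (hc : cR39 b ≠ 0) (U₁ : B.Cfg) (Gl : ↥(cubes i.D.toDomains) → BondOpY 𝔸 i)
    (Plc : ↥(cubes i.D.toDomains) → CfgY 𝔸 i → Module.End ℂ (FBondY i → 𝔸)) (P1c : ↥(cubes i.D.toDomains) → CfgY 𝔸 i → Module.End ℂ (FBondY i → 𝔸))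
    (hP1 : ∀ c, Plc c (cfg U₁) * cutMulY (hBdY i (hTY i c)) = cutMulY (hBdY i (hTY i c)) * Plc c (cfg U₁) + P1c c (cfg U₁))
    (hloc : ∀ c, cutMulY (hBdY i (hTY i c)) * (deltaLocQY i 𝔮 𝔮s (cfg U₁) - Plc c (cfg U₁)) * Gl c (cfg U₁) * cutMulY (hBdY i (hTY i c)) =
      cutMulY (hBdY i (hTY i c)) * cutMulY (hBdY i (hTY i c))) :
    S0coKq i b B cfg 𝔮 𝔮s parS Gp U₁ *
        (∑ c, mulOp (fun p : XBK κ i => hTY i c (chartY i p.1.src)) * GcoK i b B cfg (Gl c) U₁ * mulOp (fun p : XBK κ i => hTY i c (chartY i p.1.src))) =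
      1 - ∑ a, eq3105FamQLY i b 𝔮 𝔮s parS Gp Gl Plc P1c (cfg U₁) a := by
  have eM : ∀ c : ↥(cubes i.D.toDomains),
      mulOp (fun p : XBK κ i => hTY i c (chartY i p.1.src)) = coordAlgHomB i b (cutMulY (𝔸 := 𝔸) (hBdY i (hTY i c))) :=
    fun c => mulOp_bond_eq_coordOpK i b (hTY i c)
  simp only [eM, S0coKq_eq_smul_coordAlgHomB, GcoK_eq_smul_coordAlgHomB]
  rw [smul_mul_sum_smul_eq i b hc, eq3105Q_hT_ofLocalInverse i 𝔮 𝔮s parS Gp (cfg U₁) (fun c => zetaY i c)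
    (fun c z hz => zetaY_eq_one_of_hTY_ne_zero i c hz) (fun c => Gl c (cfg U₁)) (fun c => Plc c (cfg U₁)) (fun c => P1c c (cfg U₁)) hP1 hloc,
    sum_eq3105FamQLY]
  simp only [map_sub, map_sum, map_one]
  abel

/-- ★★ **THE TRANSPOSED (3.105) IN THE SAME CURRENCY AT A GENERIC FAMILY OF CUBE OPERATORS**: `Σ_□ mulOp h_□ · GcoK(G_□) U · mulOp h_□ · S0coKq U = 1 − Σ_a eq3105FamQTLY … a` under the
transposed local-inverse row `hlocT`. (transposed reading — bookkeeping) [cite: Balaban1985BackgroundPropagators, (3.105) p.414, (3.101) p.414, (3.87) p.409, p.409 l.1–5] -/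
theorem eq3105QT_coords_ofLocalInverse (hc : cR39 b ≠ 0) (U₁ : B.Cfg) (Gl : ↥(cubes i.D.toDomains) → BondOpY 𝔸 i)
    (Plc : ↥(cubes i.D.toDomains) → CfgY 𝔸 i → Module.End ℂ (FBondY i → 𝔸)) (P1c : ↥(cubes i.D.toDomains) → CfgY 𝔸 i → Module.End ℂ (FBondY i → 𝔸))
    (hP1 : ∀ c, Plc c (cfg U₁) * cutMulY (hBdY i (hTY i c)) = cutMulY (hBdY i (hTY i c)) * Plc c (cfg U₁) + P1c c (cfg U₁))
    (hlocT : ∀ c, cutMulY (hBdY i (hTY i c)) * Gl c (cfg U₁) * (deltaLocQY i 𝔮 𝔮s (cfg U₁) - Plc c (cfg U₁)) * cutMulY (hBdY i (hTY i c)) =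
      cutMulY (hBdY i (hTY i c)) * cutMulY (hBdY i (hTY i c))) :
    (∑ c, mulOp (fun p : XBK κ i => hTY i c (chartY i p.1.src)) * GcoK i b B cfg (Gl c) U₁ * mulOp (fun p : XBK κ i => hTY i c (chartY i p.1.src))) *
        S0coKq i b B cfg 𝔮 𝔮s parS Gp U₁ =
      1 - ∑ a, eq3105FamQTLY i b 𝔮 𝔮s parS Gp Gl Plc P1c (cfg U₁) a := by
  have eM : ∀ c : ↥(cubes i.D.toDomains),
      mulOp (fun p : XBK κ i => hTY i c (chartY i p.1.src)) = coordAlgHomB i b (cutMulY (𝔸 := 𝔸) (hBdY i (hTY i c))) :=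
    fun c => mulOp_bond_eq_coordOpK i b (hTY i c)
  simp only [eM, S0coKq_eq_smul_coordAlgHomB, GcoK_eq_smul_coordAlgHomB]
  rw [sum_smul_mul_smul_eq i b hc, eq3105QT_hT_ofLocalInverse i 𝔮 𝔮s parS Gp (cfg U₁) (fun c => zetaY i c)
    (fun c z hz => zetaY_eq_one_of_hTY_ne_zero i c hz) (fun c => Gl c (cfg U₁)) (fun c => Plc c (cfg U₁)) (fun c => P1c c (cfg U₁)) hP1 hlocT,
    sum_eq3105FamQTLY]
  simp only [map_sub, map_add, map_sum, map_one, Finset.sum_neg_distrib]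
  abel

end Coords

/-! ## §3 At the (C) letter of record `G_□(U) = GDirCKY i □ Pl_□ B_□ U` over `M_N(ℂ)` and the stage's knit families `(qKnitOfRecord, qsKnitOfRecord)` -/

section Record

open scoped Matrix.Norms.L2Operator

variable {N : ℕ} [Nonempty (Fin N)] {θ : Stage3Params} {ι : Type} [Fintype ι]

section Index

variable (i : KIdx θ.d₆ θ.ℓ₆ θ.hd' θ.hL' θ.b₀ θ.b₁) (b : Module.Basis ι ℝ (Matrix (Fin N) (Fin N) ℂ)) (B : B9.Backgrounds)
  (cfg : B.Cfg → CfgY (Matrix (Fin N) (Fin N) ℂ) i) (parS : SiteParY (Matrix (Fin N) (Fin N) ℂ) i) (Gp : SiteOpY (Matrix (Fin N) (Fin N) ℂ) i)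

/-- ★★★ **(3.105) IN THE WALK RECORD's COORDINATES AT THE (C) LETTER OF RECORD** `G_□(U) = GDirCKY i □ (Plc □) (Bc □) U`, the member's pair being the knit families of record:
`S0coKq U · Σ_□ mulOp h_□ · GcoK(G_□) U · mulOp h_□ = 1 − Σ_a eq3105FamQLY … (□ ↦ GDirCKY i □ (Plc □) (Bc □)) … a` — the local-inverse row a THEOREM (row agreement of the knit pairs);
displayed: the (3.101) row `hP1`, the bond support of `h_□` inside `B_□`, the regime `IsUnit (padDeltaLocCY …)` (Cor. 3.6 for the sequences).
[cite: Balaban1985BackgroundPropagators, (3.105) p.414, (3.101) p.414, (3.87) p.409, p.409 l.1–5, Cor. 3.6 p.408] -/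
theorem eq3105Q_coords_GDirCKY (hc : cR39 b ≠ 0) (U₁ : B.Cfg)
    (Plc : ↥(cubes i.D.toDomains) → CfgY (Matrix (Fin N) (Fin N) ℂ) i → Module.End ℂ (FBondY i → Matrix (Fin N) (Fin N) ℂ))
    (P1c : ↥(cubes i.D.toDomains) → CfgY (Matrix (Fin N) (Fin N) ℂ) i → Module.End ℂ (FBondY i → Matrix (Fin N) (Fin N) ℂ))
    (hP1 : ∀ c, Plc c (cfg U₁) * cutMulY (hBdY i (hTY i c)) = cutMulY (hBdY i (hTY i c)) * Plc c (cfg U₁) + P1c c (cfg U₁))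
    (Bc : ↥(cubes i.D.toDomains) → Finset (FBondY i)) (hB : ∀ c bd, hBdY i (hTY i c) bd ≠ 0 → bd ∈ Bc c)
    (hU : ∀ c : ↥(cubes i.D.toDomains), IsUnit (padDeltaLocCY i c (QknitCubeY i c) (QsknitCubeY i c) (Plc c) (Bc c) (cfg U₁))) :
    S0coKq i b B cfg (qKnitOfRecord N θ i) (qsKnitOfRecord N θ i) parS Gp U₁ *
        (∑ c : ↥(cubes i.D.toDomains), mulOp (fun p : XBK ι i => hTY i c (chartY i p.1.src)) * GcoK i b B cfg (GDirCKY i c (Plc c) (Bc c)) U₁ *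
          mulOp (fun p : XBK ι i => hTY i c (chartY i p.1.src))) =
      1 - ∑ a, eq3105FamQLY i b (qKnitOfRecord N θ i) (qsKnitOfRecord N θ i) parS Gp (fun c => GDirCKY i c (Plc c) (Bc c)) Plc P1c (cfg U₁) a := by
  have h := eq3105Q_coords_ofLocalInverse i b B cfg (qKnitOfRecord N θ i) (qsKnitOfRecord N θ i) parS Gp hc U₁ (fun c => GDirCKY i c (Plc c) (Bc c)) Plc P1c hP1
    fun c => hloc_GDirCY_of_rows i c (QknitCubeY i c) (QsknitCubeY i c) (qKnitOfRecord N θ i) (qsKnitOfRecord N θ i) (Plc c) (hU c) (hTY i c) (hB c)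
      fun A f hf => knitRecord_rows_agree_of_hTY i c (cfg U₁) A f hf
  exact h

/-- ★★★ **THE TRANSPOSED (3.105) AT THE (C) LETTER OF RECORD**, the transposed local-inverse row a THEOREM (column agreement of the knit pairs). (transposed reading — bookkeeping)
[cite: Balaban1985BackgroundPropagators, (3.105) p.414, (3.101) p.414, (3.87) p.409, p.409 l.1–5, Cor. 3.6 p.408] -/
theorem eq3105QT_coords_GDirCKY (hc : cR39 b ≠ 0) (U₁ : B.Cfg)
    (Plc : ↥(cubes i.D.toDomains) → CfgY (Matrix (Fin N) (Fin N) ℂ) i → Module.End ℂ (FBondY i → Matrix (Fin N) (Fin N) ℂ))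
    (P1c : ↥(cubes i.D.toDomains) → CfgY (Matrix (Fin N) (Fin N) ℂ) i → Module.End ℂ (FBondY i → Matrix (Fin N) (Fin N) ℂ))
    (hP1 : ∀ c, Plc c (cfg U₁) * cutMulY (hBdY i (hTY i c)) = cutMulY (hBdY i (hTY i c)) * Plc c (cfg U₁) + P1c c (cfg U₁))
    (Bc : ↥(cubes i.D.toDomains) → Finset (FBondY i)) (hB : ∀ c bd, hBdY i (hTY i c) bd ≠ 0 → bd ∈ Bc c)
    (hU : ∀ c : ↥(cubes i.D.toDomains), IsUnit (padDeltaLocCY i c (QknitCubeY i c) (QsknitCubeY i c) (Plc c) (Bc c) (cfg U₁))) :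
    (∑ c : ↥(cubes i.D.toDomains), mulOp (fun p : XBK ι i => hTY i c (chartY i p.1.src)) * GcoK i b B cfg (GDirCKY i c (Plc c) (Bc c)) U₁ *
          mulOp (fun p : XBK ι i => hTY i c (chartY i p.1.src))) * S0coKq i b B cfg (qKnitOfRecord N θ i) (qsKnitOfRecord N θ i) parS Gp U₁ =
      1 - ∑ a, eq3105FamQTLY i b (qKnitOfRecord N θ i) (qsKnitOfRecord N θ i) parS Gp (fun c => GDirCKY i c (Plc c) (Bc c)) Plc P1c (cfg U₁) a := by
  have h := eq3105QT_coords_ofLocalInverse i b B cfg (qKnitOfRecord N θ i) (qsKnitOfRecord N θ i) parS Gp hc U₁ (fun c => GDirCKY i c (Plc c) (Bc c)) Plc P1c hP1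
    fun c => hlocT_GDirCY_of_cols i c (QknitCubeY i c) (QsknitCubeY i c) (qKnitOfRecord N θ i) (qsKnitOfRecord N θ i) (Plc c) (hU c) (hTY i c) (hB c)
      fun A f => knitRecord_cols_agree_of_hTY i c (cfg U₁) A f
  exact h

end Index

/-! ### The member editions with the rows-19 record's partition letter `hWalkBY x □` (the heads' `hlawsA`.3∕.4 shape at the (C) pins) -/

section Member

open B9PinMembersKLevelV1 (MemberY)
open B9WalkLettersOps310 (hWalkBY)

variable {Mstar : ℕ} (x : MemberY θ.d₆ θ.ℓ₆ θ.hd' θ.hL' θ.b₀ θ.b₁ Mstar) (b : Module.Basis ι ℝ (Matrix (Fin N) (Fin N) ℂ)) (B : B9.Backgrounds)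
  (cfg : B.Cfg → CfgY (Matrix (Fin N) (Fin N) ℂ) x.toKIdx) (parS : SiteParY (Matrix (Fin N) (Fin N) ℂ) x.toKIdx) (Gp : SiteOpY (Matrix (Fin N) (Fin N) ℂ) x.toKIdx)

/-- ★★★ (3.105) in the rows-19 record's coordinates AT A MEMBER with the (C) letter of record, the partition read as `hWalkBY x □`.
[cite: Balaban1985BackgroundPropagators, (3.105) p.414, (3.101) p.414, (3.87) p.409, p.409 l.1–5, Cor. 3.6 p.408] -/
theorem eq3105Q_coords_GDirCKY_member (hc : cR39 b ≠ 0) (U₁ : B.Cfg)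
    (Plc : ↥(cubes x.toKIdx.D.toDomains) → CfgY (Matrix (Fin N) (Fin N) ℂ) x.toKIdx → Module.End ℂ (FBondY x.toKIdx → Matrix (Fin N) (Fin N) ℂ))
    (P1c : ↥(cubes x.toKIdx.D.toDomains) → CfgY (Matrix (Fin N) (Fin N) ℂ) x.toKIdx → Module.End ℂ (FBondY x.toKIdx → Matrix (Fin N) (Fin N) ℂ))
    (hP1 : ∀ c, Plc c (cfg U₁) * cutMulY (hBdY x.toKIdx (hTY x.toKIdx c)) = cutMulY (hBdY x.toKIdx (hTY x.toKIdx c)) * Plc c (cfg U₁) + P1c c (cfg U₁))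
    (Bc : ↥(cubes x.toKIdx.D.toDomains) → Finset (FBondY x.toKIdx)) (hB : ∀ c bd, hBdY x.toKIdx (hTY x.toKIdx c) bd ≠ 0 → bd ∈ Bc c)
    (hU : ∀ c : ↥(cubes x.toKIdx.D.toDomains),
      IsUnit (padDeltaLocCY x.toKIdx c (QknitCubeY x.toKIdx c) (QsknitCubeY x.toKIdx c) (Plc c) (Bc c) (cfg U₁))) :
    S0coKq x.toKIdx b B cfg (qKnitOfRecord N θ x.toKIdx) (qsKnitOfRecord N θ x.toKIdx) parS Gp U₁ *
        (∑ c : ↥(cubes x.toKIdx.D.toDomains), mulOp (hWalkBY (κ := ι) x c) * GcoK x.toKIdx b B cfg (GDirCKY x.toKIdx c (Plc c) (Bc c)) U₁ *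
          mulOp (hWalkBY (κ := ι) x c)) =
      1 - ∑ a, eq3105FamQLY x.toKIdx b (qKnitOfRecord N θ x.toKIdx) (qsKnitOfRecord N θ x.toKIdx) parS Gp (fun c => GDirCKY x.toKIdx c (Plc c) (Bc c)) Plc P1c
        (cfg U₁) a := by
  have h := eq3105Q_coords_GDirCKY x.toKIdx b B cfg parS Gp hc U₁ Plc P1c hP1 Bc hB hU
  exact h

/-- ★★★ the transposed reading at a member with the (C) letter of record. (transposed reading — bookkeeping)
[cite: Balaban1985BackgroundPropagators, (3.105) p.414, (3.101) p.414, (3.87) p.409, p.409 l.1–5, Cor. 3.6 p.408] -/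
theorem eq3105QT_coords_GDirCKY_member (hc : cR39 b ≠ 0) (U₁ : B.Cfg)
    (Plc : ↥(cubes x.toKIdx.D.toDomains) → CfgY (Matrix (Fin N) (Fin N) ℂ) x.toKIdx → Module.End ℂ (FBondY x.toKIdx → Matrix (Fin N) (Fin N) ℂ))
    (P1c : ↥(cubes x.toKIdx.D.toDomains) → CfgY (Matrix (Fin N) (Fin N) ℂ) x.toKIdx → Module.End ℂ (FBondY x.toKIdx → Matrix (Fin N) (Fin N) ℂ))
    (hP1 : ∀ c, Plc c (cfg U₁) * cutMulY (hBdY x.toKIdx (hTY x.toKIdx c)) = cutMulY (hBdY x.toKIdx (hTY x.toKIdx c)) * Plc c (cfg U₁) + P1c c (cfg U₁))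
    (Bc : ↥(cubes x.toKIdx.D.toDomains) → Finset (FBondY x.toKIdx)) (hB : ∀ c bd, hBdY x.toKIdx (hTY x.toKIdx c) bd ≠ 0 → bd ∈ Bc c)
    (hU : ∀ c : ↥(cubes x.toKIdx.D.toDomains),
      IsUnit (padDeltaLocCY x.toKIdx c (QknitCubeY x.toKIdx c) (QsknitCubeY x.toKIdx c) (Plc c) (Bc c) (cfg U₁))) :
    (∑ c : ↥(cubes x.toKIdx.D.toDomains), mulOp (hWalkBY (κ := ι) x c) * GcoK x.toKIdx b B cfg (GDirCKY x.toKIdx c (Plc c) (Bc c)) U₁ *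
          mulOp (hWalkBY (κ := ι) x c)) * S0coKq x.toKIdx b B cfg (qKnitOfRecord N θ x.toKIdx) (qsKnitOfRecord N θ x.toKIdx) parS Gp U₁ =
      1 - ∑ a, eq3105FamQTLY x.toKIdx b (qKnitOfRecord N θ x.toKIdx) (qsKnitOfRecord N θ x.toKIdx) parS Gp (fun c => GDirCKY x.toKIdx c (Plc c) (Bc c)) Plc P1c
        (cfg U₁) a := by
  have h := eq3105QT_coords_GDirCKY x.toKIdx b B cfg parS Gp hc U₁ Plc P1c hP1 Bc hB hU
  exact h

end Member

end Record

end Literature.MathematicalPhysics.QuantumFieldTheory.Balaban1983to89.B9Eq3105CoordsDirichletBondLY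

end
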